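import Summits.Langlands.Langlands.Theorems.IrreducibilityBySelfDualityIrreducibleOffSectorArtinType
import Summits.Langlands.Langlands.Theorems.IrreducibilityBySelfDualityIrreducibleOffSectorTensorProduct
import Summits.Langlands.Langlands.Theorems.IrreducibilityBySelfDualityContragredientDatum
import Literature.NumberTheory.GaloisRepresentations.FramedRepDualIrreducible
import HarnessLib

/-!
# `IrreducibleOffSector`: the CONTRAGREDIENT (duality) closure operator
(crux stmt-Langlands-14329 `IrreducibilityBySelfDuality.IrreducibleOffSector`, line `Sketch`;
`--supports` file, STRUCTURAL: no import of the route module; continuation lead c6)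

Sixth closure operator on the crux's conclusion (twists p120193, base-change descent p121124,
automorphic-induction ascent p122816, tensor-product ascent p124532, symmetric-power ascent of this
lead): DUALITY.  Let `π'` be a contragredient of the automorphic datum `π` at Satake level
(`t_{π',v} = t_{π,v}⁻¹` at almost all places; for cuspidal Borel–Jacquet data such a `π'` exists and is
cuspidal — the route item `ContragredientDatum`, PROVED: `ContragredientDatum_proof`, `g ↦ ᵗg⁻¹` on
cusp forms).  If every `ρ' : Γ_K → GL_n(ℚ̄_ℓ)` Satake–Frobenius compatible with `(π', ι)` at almost all
places is irreducible, then so is every `ρ` compatible with `(π, ι)`: the framed dual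
`ρ^∨ = ᵗρ⁻¹` (`FramedRep.dual`) is compatible with `(π', ι)` — its Frobenius polynomials have the inverse
roots (`charpoly_inv_eq_prod_of_charpoly_eq_prod`, p119699) and the Satake dictionary `a ↦ ι⁻¹(a⁻¹)`
inverts with `a` —, hence irreducible, and `ρ = (ρ^∨)^∨` is irreducible with it
(`FramedRep.isIrreducible_toContinuousRep_dual`, Literature `FramedRepDualIrreducible`).

* `charpoly_dual_eq_prod`, `dual_apply_eq_one`, `dual_dual` — the framed dual: characteristic
  polynomials (inverse roots), kernel, involutivity;
* `isUnramifiedAt_dual`, `hasFrobCharpolyAt_dual`, `arithFrobPolyOfSatake_one_map_inv`,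
  `hasFrobCharpolyAt_dual_arithFrobPolyOfSatake` — Galois predicates and the Satake side;
* `eventually_satakeFrobCompatibleAt_dual` — `ρ^∨` is an a.e.-compatible avatar of the contragredient;
* `isIrreducible_of_contragredient` — **the operator**;
* `irreducibleOffSector_conclusion_of_contragredient` — binder shape of the crux for cuspidal `π`:
  the crux's conclusion for the cuspidal contragredient data of `π` (at the same `ℓ`, `ι`) implies it
  for `π`; with `t_{π''} = t_π` for a contragredient `π''` of `π'`, the set of `(π, ℓ, ι)` at which the
  conclusion holds is stable under `π ↦ π^∨`.

References: A. Borel, H. Jacquet, Proc. Sympos. Pure Math. 33 (1979), part 1, §5 (contragredient);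
H. Jacquet, J. Shalika, Amer. J. Math. 103 (1981), (1.2) (`t_{π̃} = t_π⁻¹`); J.-P. Serre, *Linear
representations of finite groups* (1977), §1.4 (d); K. Buzzard, T. Gee, LMS LNS 414 (2014), §2.1.
-/

noncomputable section

set_option linter.dupNamespace false

open scoped NumberField Classical Polynomial MatrixGroups
open Filter IsDedekindDomain Polynomial
open Literature.NumberTheory.Automorphic Literature.NumberTheory.GaloisRepresentations
open Summit.Langlands

namespace Summit.Langlands.Langlands.Theorems.IrreducibleOffSector

/-! ## 1. The framed dual: characteristic polynomials, kernel, involutivity -/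

section Dual

variable {G : Type*} [Group G] [TopologicalSpace G]

/-- **`χ_{ρ^∨(g)} = ∏ (X - c⁻¹)` when `χ_{ρ(g)} = ∏ (X - c)`** (field coefficients): the dual is
`ᵗρ(g)⁻¹`, transposition does not change the characteristic polynomial (Mathlib
`Matrix.charpoly_transpose`) and inversion inverts the roots (`charpoly_inv_eq_prod_of_charpoly_eq_prod`).
[cite: SerreLinearRepresentations1977, §1.4 (d)] -/
theorem charpoly_dual_eq_prod {F : Type*} [Field F] [TopologicalSpace F] {n : ℕ}
    (ρ : FramedRep G F n) {g : G} {s : Multiset F}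
    (h : FramedRep.charpoly ρ g = (s.map fun c => X - C c).prod) :
    FramedRep.charpoly (FramedRep.dual ρ) g = (s.map fun c => X - C c⁻¹).prod := by
  unfold FramedRep.charpoly at h ⊢
  rw [FramedRep.coe_dual_apply, Matrix.charpoly_transpose, Matrix.coe_units_inv]
  exact charpoly_inv_eq_prod_of_charpoly_eq_prod (Units.isUnit _) h

/-- `ρ g = 1 ⇒ ρ^∨ g = 1`. [folklore] -/
theorem dual_apply_eq_one {A : Type*} [CommRing A] [TopologicalSpace A] {n : ℕ} (ρ : FramedRep G A n)
    {g : G} (h : ρ g = 1) : FramedRep.dual ρ g = 1 := by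
  apply Units.ext
  rw [FramedRep.coe_dual_apply, h, inv_one, Units.val_one, Matrix.transpose_one]

/-- **`(ρ^∨)^∨ = ρ`** (`ᵗ(ᵗg⁻¹)⁻¹ = g`). [cite: SerreLinearRepresentations1977, §1.4 (d)] -/
theorem dual_dual {A : Type*} [CommRing A] [TopologicalSpace A] {n : ℕ} (ρ : FramedRep G A n) :
    FramedRep.dual (FramedRep.dual ρ) = ρ := by
  apply ContinuousMonoidHom.ext
  intro g
  apply Units.ext
  rfl

end Dual

/-! ## 2. Galois predicates and the Satake side -/

section Galois

variable {K : Type} [Field K] {A : Type*} [CommRing A] [TopologicalSpace A] {n : ℕ}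

/-- **`ρ^∨` is unramified wherever `ρ` is.** [cite: SerreAbelianLadic1968, Ch. I §2.1] -/
theorem isUnramifiedAt_dual (ρ : FramedGaloisRep K A n) {v : HeightOneSpectrum (𝓞 K)}
    (h : ρ.IsUnramifiedAt v) : FramedGaloisRep.IsUnramifiedAt v (FramedRep.dual ρ) :=
  fun 𝔓 h𝔓 σ hσ => dual_apply_eq_one ρ (h 𝔓 h𝔓 σ hσ)

/-- **Frobenius polynomials of `ρ^∨` have the inverse roots** (field coefficients).
[cite: SerreLinearRepresentations1977, §1.4 (d)] -/
theorem hasFrobCharpolyAt_dual {F : Type*} [Field F] [TopologicalSpace F] (ρ : FramedGaloisRep K F n)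
    {v : HeightOneSpectrum (𝓞 K)} {s : Multiset F}
    (h : ρ.HasFrobCharpolyAt v (s.map fun c => X - C c).prod) :
    FramedGaloisRep.HasFrobCharpolyAt v (s.map fun c => X - C c⁻¹).prod (FramedRep.dual ρ) :=
  fun 𝔓 h𝔓 σ hσ => charpoly_dual_eq_prod ρ (h 𝔓 h𝔓 σ hσ)

variable {ℓ : ℕ} [Fact ℓ.Prime]

/-- **The predicted Frobenius polynomial of the inverse Satake parameter** `α⁻¹ = {a⁻¹}` is the
inverse-roots polynomial of that of `α`: `ι⁻¹((a⁻¹)⁻¹) = (ι⁻¹(a⁻¹))⁻¹`. [cite: BuzzardGeeLMS2014, §2.1] -/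
theorem arithFrobPolyOfSatake_one_map_inv (ι : PadicAlgCl ℓ ≃+* ℂ) (q : ℕ) (α : Multiset ℂ) :
    arithFrobPolyOfSatake ι q 1 (α.map fun a => a⁻¹) =
      ((α.map fun a => ι.symm a⁻¹).map fun c => X - C c⁻¹).prod := by
  rw [arithFrobPolyOfSatake_one_eq_prod_map, Multiset.map_map, Multiset.map_map, Multiset.map_map]
  congr 1
  refine Multiset.map_congr rfl fun a _ => ?_
  simp only [Function.comp_apply, inv_inv, map_inv₀]

/-- **Dual of a Satake-compatible avatar.**  If the arithmetic Frobenii at `v` have characteristic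
polynomial `arithFrobPolyOfSatake ι q 1 α` on `ρ`, then on `ρ^∨` they have characteristic polynomial
`arithFrobPolyOfSatake ι q 1 α⁻¹` — the unramified local contragredient `t_{π̃,v} = t_{π,v}⁻¹` on the
Galois side. [cite: BuzzardGeeLMS2014, §2.1] [cite: JacquetShalikaAJM1981, (1.2)] -/
theorem hasFrobCharpolyAt_dual_arithFrobPolyOfSatake (ρ : FramedGaloisRep K (PadicAlgCl ℓ) n)
    (ι : PadicAlgCl ℓ ≃+* ℂ) {v : HeightOneSpectrum (𝓞 K)} (q : ℕ) {α : Multiset ℂ}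
    (h : ρ.HasFrobCharpolyAt v (arithFrobPolyOfSatake ι q 1 α)) :
    FramedGaloisRep.HasFrobCharpolyAt v (arithFrobPolyOfSatake ι q 1 (α.map fun a => a⁻¹))
      (FramedRep.dual ρ) := by
  rw [arithFrobPolyOfSatake_one_map_inv]
  rw [arithFrobPolyOfSatake_one_eq_prod_map] at h
  exact hasFrobCharpolyAt_dual ρ h

end Galois

/-! ## 3. The operator -/

section Operator

variable {K : Type} [Field K] [NumberField K] {ℓ : ℕ} [Fact ℓ.Prime] {n : ℕ}
  {hcpt hcpt' : isCompact_glFiniteIntegralLevel n K}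

/-- **The dual of an avatar is an avatar of the contragredient.**  Let `π'` be a contragredient of
`π` at Satake level (`t_{π',v} = t_{π,v}⁻¹` a.e.) and `ρ` Satake–Frobenius compatible with `(π, ι)` at
almost all places.  Then `ρ^∨` is Satake–Frobenius compatible with `(π', ι)` at almost all places
(`hasFrobCharpolyAt_dual_arithFrobPolyOfSatake`, `isUnramifiedAt_dual`, a.e.-unramifiedness of `π'`).
[cite: JacquetShalikaAJM1981, (1.2)] [cite: BuzzardGeeLMS2014, §2.1] -/
theorem eventually_satakeFrobCompatibleAt_dual (ι : PadicAlgCl ℓ ≃+* ℂ)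
    (π : AutomorphicRepData (AutomorphyDatum.gl n K hcpt))
    (π' : AutomorphicRepData (AutomorphyDatum.gl n K hcpt'))
    (hdual : ∀ᶠ v : HeightOneSpectrum (𝓞 K) in cofinite, ∀ α β : Multiset ℂ,
      π.HasSatakeParamAt v α → π'.HasSatakeParamAt v β → β = α.map fun a => a⁻¹)
    {ρ : FramedGaloisRep K (PadicAlgCl ℓ) n}
    (hρ : ∀ᶠ v : HeightOneSpectrum (𝓞 K) in cofinite, SatakeFrobCompatibleAt ι π ρ v) :
    ∀ᶠ v : HeightOneSpectrum (𝓞 K) in cofinite, SatakeFrobCompatibleAt ι π' (FramedRep.dual ρ) v := by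
  filter_upwards [hdual, hρ, AutomorphicRepData.hasSatakeParamAt_cofinite_holds π'] with v hdv hρv hπ'v
  obtain ⟨α, hα, hur, hcp⟩ := hρv
  obtain ⟨β, hβ⟩ := hπ'v
  refine ⟨β, hβ, isUnramifiedAt_dual ρ hur, ?_⟩
  rw [hdv α β hα hβ]
  exact hasFrobCharpolyAt_dual_arithFrobPolyOfSatake ρ ι v.residueCard hcp

/-- **CONTRAGREDIENT CLOSURE of the crux's conclusion.**  Let `π'` be a contragredient of `π` at
Satake level (`t_{π',v} = t_{π,v}⁻¹` a.e.).  If every `ρ' : Γ_K → GL_n(ℚ̄_ℓ)` Satake–Frobenius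
compatible with `(π', ι)` at almost all places is irreducible, then every `ρ` compatible with `(π, ι)`
is irreducible: `ρ^∨` is compatible with `(π', ι)` (`eventually_satakeFrobCompatibleAt_dual`), hence
irreducible, and `ρ = (ρ^∨)^∨` (`dual_dual`) is the dual of an irreducible representation over a field
(`FramedRep.isIrreducible_toContinuousRep_dual`). [cite: SerreLinearRepresentations1977, §1.4 (d)]
[cite: JacquetShalikaAJM1981, (1.2)] -/
theorem isIrreducible_of_contragredient (ι : PadicAlgCl ℓ ≃+* ℂ)
    (π : AutomorphicRepData (AutomorphyDatum.gl n K hcpt))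
    (π' : AutomorphicRepData (AutomorphyDatum.gl n K hcpt'))
    (hdual : ∀ᶠ v : HeightOneSpectrum (𝓞 K) in cofinite, ∀ α β : Multiset ℂ,
      π.HasSatakeParamAt v α → π'.HasSatakeParamAt v β → β = α.map fun a => a⁻¹)
    (hirr' : ∀ ρ' : FramedGaloisRep K (PadicAlgCl ℓ) n,
      (∀ᶠ v : HeightOneSpectrum (𝓞 K) in cofinite, SatakeFrobCompatibleAt ι π' ρ' v) →
        ρ'.toGaloisRep.IsIrreducible)
    (ρ : FramedGaloisRep K (PadicAlgCl ℓ) n)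
    (hρ : ∀ᶠ v : HeightOneSpectrum (𝓞 K) in cofinite, SatakeFrobCompatibleAt ι π ρ v) :
    ρ.toGaloisRep.IsIrreducible := by
  have h := hirr' _ (eventually_satakeFrobCompatibleAt_dual ι π π' hdual hρ)
  rw [← dual_dual ρ]
  exact FramedRep.isIrreducible_toContinuousRep_dual _ h

end Operator

/-! ## 4. In the binder shape of the crux (cuspidal `π`: contragredient data exist) -/

/-- **The crux's conclusion passes from the contragredient data of a cuspidal `π` to `π`.**  For
`π` cuspidal on `GL_n(𝔸_K)` there is a cuspidal contragredient datum `π'` with `t_{π',v} = t_{π,v}⁻¹` at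
every unramified place (the route item `ContragredientDatum`, PROVED: `ContragredientDatum_proof`);
if the crux's conclusion holds at `(ℓ, ι)` for every such `π'` (all cuspidal data with the inverse
Satake parameters of `π`), then it holds for `π` at `(ℓ, ι)` (`isIrreducible_of_contragredient`,
Satake parameters are unique: `hasSatakeParamAt_unique_holds`).  Binder shape of the crux; the
L-algebraicity / off-sector hypotheses are carried, not used.
[cite: BorelJacquetCorvallis1979, §5] [cite: JacquetShalikaAJM1981, (1.2)] -/
theorem irreducibleOffSector_conclusion_of_contragredient :
    ∀ (n : ℕ) (K : Type) [Field K] [NumberField K] (hcpt : isCompact_glFiniteIntegralLevel n K),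
      0 < n → ∀ (π : CuspidalAutomorphicRepData n K hcpt) (ℓ : ℕ) [Fact ℓ.Prime] (ι : PadicAlgCl ℓ ≃+* ℂ),
        (∀ π' : CuspidalAutomorphicRepData n K hcpt,
          (∀ (v : HeightOneSpectrum (𝓞 K)) (α : Multiset ℂ), π.1.HasSatakeParamAt v α →
              π'.1.HasSatakeParamAt v (α.map fun a => a⁻¹)) →
            ∀ ρ' : FramedGaloisRep K (PadicAlgCl ℓ) n,
              (∀ᶠ v : HeightOneSpectrum (𝓞 K) in cofinite, SatakeFrobCompatibleAt ι π'.1 ρ' v) →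
                ρ'.toGaloisRep.IsIrreducible) →
        π.1.IsLAlgebraic →
        ¬ (n = 3 ∧ NumberField.IsCMField K ∧
            ∃ T : InfinityType K n, π.1.HasInfinityType T ∧ T.IsRegular) →
        ∀ ρ : FramedGaloisRep K (PadicAlgCl ℓ) n,
          (∀ᶠ v : HeightOneSpectrum (𝓞 K) in cofinite, SatakeFrobCompatibleAt ι π.1 ρ v) →
            ρ.toGaloisRep.IsIrreducible := by
  intro n K _ _ hcpt _hn π ℓ _ ι hdualAll _hL _hsec ρ hρ
  obtain ⟨π', hπ'⟩ := ContragredientDatum.ContragredientDatum_proof n K hcpt π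
  refine isIrreducible_of_contragredient ι π.1 π'.1 (Filter.Eventually.of_forall fun v α β hα hβ => ?_)
    (hdualAll π' hπ') ρ hρ
  exact AutomorphicRepData.hasSatakeParamAt_unique_holds π'.1 hβ (hπ' v α hα)

end Summit.Langlands.Langlands.Theorems.IrreducibleOffSector

end
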